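import Summits.QuantumFields.BalabanUV.Beta.ChartConjugationRelative

/-!
# `BalabanUV.Beta.D1BFx.HessKerConjugation` — road «BF-x» for binder row D1, junction (J1), the `Δ_n` Ward program (R-D1-g43-3 (2)), brick W-2∕W-3 of
# `HOME/b2b-balaban-beta-d1-p2/J1-DEFECT-WORDS.md` v0 §6: **THE ONE-LOOP FUNCTIONAL OF A CONJUGATED KERNEL IS THE FUNCTIONAL OF THE KERNEL ON
# CONJUGATED VERTICES** (tame cyclicity, nothing else):
#   `tadpole (P∘K∘Pᵀ) X = tadpole K (Pᵀ∘X∘P)`,  `bubble (P∘K∘Pᵀ) V V′ = bubble K (Pᵀ∘V∘P) (Pᵀ∘V′∘P)`,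
#   `hessKer (P∘K∘Pᵀ) V W = hessKer K (Pᵀ·V·P) (Pᵀ·W·P)`
# for spread `P, K` and localised vertex kernels (`Pᵀ = trK P`).  At `P := Ψ̂_S = psiKS (ctrOff (d+1) n) n` (d1-formalise-leaf-03 g28's «CHART-TRANSPORT»
# `SymCorrectorTransport.GcombSh_zero_eq_conj_psiKS_KInvStep`: `GcombSh n 0 = Ψ̂_S ∘ G₀^{bm}(ctrOff) ∘ Ψ̂_Sᵀ`) and `K := G₀^{bm}(ctrOff)` this is (T-leg) of the words
# file: the chart defect `Δ_n = F(GcombSh; jets) − F(G₀; jets)` of PART 22∕23-hyb's ONE ROW `hC₁` moves the (nilpotent, block-local) window `Ψ̂_S` OFF the resolvent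
# lines ONTO the vertex kernels, leaving every resolvent line at the road's own kernel `G₀`.

HONEST DEPENDENCY (cell records, verbatim): «continuum YM on T⁴ ⇐ BetaPertH ∧ nine spine estimates (0/9 proved); BetaPertH ⇐ (D1) ∧ (D4) ∧
CAP+tail; G-an2-4 gates asym, D1 and NE2/3/4.»  HONEST FRAMING (cell contract, verbatim): «discharging `BetaPertH` makes Bałaban's UV stability
UNCONDITIONAL — a real constructive-QFT result; it is NOT the continuum limit and NOT the Clay problem.»  THIS MODULE DISCHARGES NOTHING of (J1),
of (K), of D1 or of the wall: [folklore] trace cyclicity (`TameKernelCalculus.tr_comp_comm_loc`) and associativity (`comp_assoc_tame`) in the tame kernel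
calculus.  No definition, no `def … : Prop`, nothing cited, 0 sorry.  0 root-level binders of row D1 discharged; (J1) OPEN; NOT D1, NOT `BetaPertH`, NOT
continuum, NOT Clay.

ABSOLUTE RULE (cell charter, verbatim): «No internally-minted statement may enter as a cited fact. Every hypothesis is either kernel-proved in this
package or a verbatim quotation of a PUBLISHED theorem with page reference. The manuscript(s) under audit are NOT citable for their own disputed
steps — they are the thing under adjudication; programme-internal (2001/route/tribunal) claims are never citable.»

CONTENT (all [folklore]): `tr_conj_comp` (`tr ((P∘K∘Pᵀ)∘X) = tr (K∘(Pᵀ∘X∘P))`), `tadpole_conj_kernel`, `comp_conj_comp_conj` (the bubble's integrand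
re-associated), `bubble_conj_kernel`, **`hessKer_conj_kernel`** (§1–§3, (T-leg)); §4 **`colH_conj_kernel`** ((T-col), generic: for a window `P` with
identity multiplier block and vanishing mixed blocks, `colH (P∘K∘Pᵀ) = P_ff · colH K`); §5 the WORD LIST at a fixed kernel (words file §4):
`bubble_add_add`, `hessKer_add_add`, **`hessKer_add_add_sub`** (`hessKer K (V + Vᵈ) (W + Wᵈ) − hessKer K V W = ½·tadpole K Wᵈ − ½·(two cross bubbles) − ½·bubble K Vᵈ Vᵈ`
— the classes (D-T)∕(D-R), (D-X), (D-C)), `hessKer_add_left_sub`, `hessKer_add_right_sub`.  Unit `b2b-balaban-beta-d1-p2` (road owner, gen 22), 2026-08-22.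
-/

noncomputable section

namespace Summit.QuantumFields.BalabanUV.Beta.D1BFx.HessKerConjugation

open Literature.MathematicalPhysics.QuantumFieldTheory.Balaban1983to89
open Literature.MathematicalPhysics.QuantumFieldTheory.Balaban1983to89.Beta
open ExpKernelCalculus (MKer comp tr tadpole bubble hessKer)
open Summit.QuantumFields.BalabanUV.Beta.TameKernelCalculus
open Summit.QuantumFields.BalabanUV.Beta.ChartConjugationRelative (spr_comp)

variable {D : ℕ} {F : Type*} [Fintype F]

/-! ## §1 The tadpole -/

/-- [folklore] **`tr ((P∘K∘Pᵀ)∘X) = tr (K∘((Pᵀ∘X)∘P))`** for spread `P, K` and localised `X`: two cyclic moves (`tr_comp_comm_loc`) and three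
re-associations (`comp_assoc_tame`). -/
theorem tr_conj_comp {P K X : MKer D F} (hP : Spr P) (hK : Spr K) (hX : Loc X) :
    tr (comp (comp (comp P K) (trK P)) X) = tr (comp K (comp (comp (trK P) X) P)) := by
  have hPK : Spr (comp P K) := spr_comp hP hK
  have hPt : Spr (trK P) := hP.trK
  have hA : Spr (comp (comp P K) (trK P)) := spr_comp hPK hPt
  -- move `X` to the front
  have h1 : tr (comp (comp (comp P K) (trK P)) X) = tr (comp X (comp (comp P K) (trK P))) :=
    (tr_comp_comm_loc hX hA.tame).symm
  -- re-associate `X ∘ ((P∘K)∘Pᵀ) = ((X∘P)∘K)∘Pᵀ`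
  have h2 : comp X (comp (comp P K) (trK P)) = comp (comp (comp X P) K) (trK P) := by
    rw [comp_assoc_tame hX.tame hPK.tame hPt.tame, comp_assoc_tame hX.tame hP.tame hK.tame]
  -- cycle `Pᵀ` to the front: `tr (((X∘P)∘K)∘Pᵀ) = tr (Pᵀ∘((X∘P)∘K))`
  have hXPK : Loc (comp (comp X P) K) := (hX.comp_spr hP).comp_spr hK
  have h3 : tr (comp (comp (comp X P) K) (trK P)) = tr (comp (trK P) (comp (comp X P) K)) := tr_comp_comm_loc hXPK hPt.tame
  -- re-associate `Pᵀ∘((X∘P)∘K) = ((Pᵀ∘X)∘P)∘K`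
  have h4 : comp (trK P) (comp (comp X P) K) = comp (comp (comp (trK P) X) P) K := by
    rw [comp_assoc_tame hPt.tame (hX.comp_spr hP).tame hK.tame, comp_assoc_tame hPt.tame hX.tame hP.tame]
  -- cycle `K` to the front
  have hPXP : Loc (comp (comp (trK P) X) P) := (hPt.comp_loc hX).comp_spr hP
  have h5 : tr (comp (comp (comp (trK P) X) P) K) = tr (comp K (comp (comp (trK P) X) P)) := tr_comp_comm_loc hPXP hK.tame
  rw [h1, h2, h3, h4, h5]

/-- [folklore] **TADPOLE OF A CONJUGATED KERNEL**: `tadpole (P∘K∘Pᵀ) X = tadpole K (Pᵀ∘X∘P)`. -/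
theorem tadpole_conj_kernel {P K X : MKer D F} (hP : Spr P) (hK : Spr K) (hX : Loc X) :
    tadpole (comp (comp P K) (trK P)) X = tadpole K (comp (comp (trK P) X) P) := by
  unfold ExpKernelCalculus.tadpole
  exact tr_conj_comp hP hK hX

/-! ## §2 The bubble -/

/-- [folklore] The bubble's integrand re-associated with the leading `P` isolated: `((P∘K∘Pᵀ)∘V)∘((P∘K∘Pᵀ)∘V′) = P∘(((K∘(Pᵀ∘V∘P))∘K)∘(Pᵀ∘V′))` —
pure associativity; the one cyclic move of that leading `P` is done in `bubble_conj_kernel`. -/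
theorem comp_conj_comp_conj {P K V V' : MKer D F} (hP : Spr P) (hK : Spr K) (hV : Loc V) (hV' : Loc V') :
    comp (comp (comp (comp P K) (trK P)) V) (comp (comp (comp P K) (trK P)) V')
      = comp P (comp (comp (comp K (comp (comp (trK P) V) P)) K) (comp (trK P) V')) := by
  have hPt : Spr (trK P) := hP.trK
  have hPK : Spr (comp P K) := spr_comp hP hK
  have hA : Spr (comp (comp P K) (trK P)) := spr_comp hPK hPt
  have hPV : Loc (comp (trK P) V) := hPt.comp_loc hV
  have hPVP : Loc (comp (comp (trK P) V) P) := hPV.comp_spr hP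
  have hPV' : Loc (comp (trK P) V') := hPt.comp_loc hV'
  -- left factor: `((P∘K)∘Pᵀ)∘V = (P∘K)∘(Pᵀ∘V) = P∘(K∘(Pᵀ∘V))`
  have hL : comp (comp (comp P K) (trK P)) V = comp P (comp K (comp (trK P) V)) := by
    rw [← comp_assoc_tame hPK.tame hPt.tame hV.tame, ← comp_assoc_tame hP.tame hK.tame hPV.tame]
  -- right factor: `((P∘K)∘Pᵀ)∘V′ = (P∘K)∘(Pᵀ∘V′)`
  have hR : comp (comp (comp P K) (trK P)) V' = comp (comp P K) (comp (trK P) V') := by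
    rw [← comp_assoc_tame hPK.tame hPt.tame hV'.tame]
  rw [hL, hR]
  -- `(P∘(K∘(PᵀV))) ∘ ((P∘K)∘(PᵀV′)) = P ∘ ((K∘(PᵀV)) ∘ ((P∘K)∘(PᵀV′)))`
  have hKPV : Loc (comp K (comp (trK P) V)) := hK.comp_loc hPV
  have hPKPV' : Loc (comp (comp P K) (comp (trK P) V')) := hPK.comp_loc hPV'
  rw [← comp_assoc_tame hP.tame hKPV.tame hPKPV'.tame]
  congr 1
  -- `(K∘(PᵀV)) ∘ ((P∘K)∘(PᵀV′)) = ((K∘(PᵀV))∘(P∘K)) ∘ (PᵀV′) = (((K∘(PᵀV))∘P)∘K) ∘ (PᵀV′) = ((K∘((PᵀV)∘P))∘K) ∘ (PᵀV′)`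
  rw [comp_assoc_tame hKPV.tame hPK.tame hPV'.tame, comp_assoc_tame hKPV.tame hP.tame hK.tame,
    ← comp_assoc_tame hK.tame hPV.tame hP.tame]

/-- [folklore] **BUBBLE OF A CONJUGATED KERNEL**: `bubble (P∘K∘Pᵀ) V V′ = bubble K (Pᵀ∘V∘P) (Pᵀ∘V′∘P)`. -/
theorem bubble_conj_kernel {P K V V' : MKer D F} (hP : Spr P) (hK : Spr K) (hV : Loc V) (hV' : Loc V') :
    bubble (comp (comp P K) (trK P)) V V' = bubble K (comp (comp (trK P) V) P) (comp (comp (trK P) V') P) := by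
  have hPt : Spr (trK P) := hP.trK
  have hPVP : Loc (comp (comp (trK P) V) P) := (hPt.comp_loc hV).comp_spr hP
  have hPV' : Loc (comp (trK P) V') := hPt.comp_loc hV'
  have hPV'P : Loc (comp (comp (trK P) V') P) := hPV'.comp_spr hP
  unfold ExpKernelCalculus.bubble
  rw [comp_conj_comp_conj hP hK hV hV']
  -- `Y := ((K∘(PᵀVP))∘K)∘(PᵀV′)` is localised; cycle the leading `P` to the end
  have hY : Loc (comp (comp (comp K (comp (comp (trK P) V) P)) K) (comp (trK P) V')) :=
    ((hK.comp_loc hPVP).comp_spr hK).comp hPV'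
  rw [← tr_comp_comm_loc hY hP.tame]
  -- `Y∘P = ((K∘(PᵀVP))∘K)∘((PᵀV′)∘P) = (K∘(PᵀVP))∘(K∘(PᵀV′P))`
  have hKPVP : Loc (comp K (comp (comp (trK P) V) P)) := hK.comp_loc hPVP
  rw [← comp_assoc_tame (hKPVP.comp_spr hK).tame hPV'.tame hP.tame, ← comp_assoc_tame hKPVP.tame hK.tame hPV'P.tame]

/-! ## §3 The one-loop Hessian kernel -/

/-- [folklore] **THE ONE-LOOP FUNCTIONAL OF A CONJUGATED KERNEL** (W-2∕W-3 of `J1-DEFECT-WORDS.md` §6, (T-leg)):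
`hessKer (P∘K∘Pᵀ) V W μ ν z = hessKer K (μ y ↦ Pᵀ∘V μ y∘P) (μ y ν y′ ↦ Pᵀ∘W μ y ν y′∘P) μ ν z` for spread `P, K` and localised vertex families. -/
theorem hessKer_conj_kernel {P K : MKer D F} (hP : Spr P) (hK : Spr K)
    {V : Fin D → (Fin D → ℤ) → MKer D F} {W : Fin D → (Fin D → ℤ) → Fin D → (Fin D → ℤ) → MKer D F}
    (hV : ∀ μ y, Loc (V μ y)) (hW : ∀ μ y ν y', Loc (W μ y ν y')) (μ ν : Fin D) (z : Fin D → ℤ) :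
    hessKer (comp (comp P K) (trK P)) V W μ ν z
      = hessKer K (fun μ' y => comp (comp (trK P) (V μ' y)) P) (fun μ' y ν' y' => comp (comp (trK P) (W μ' y ν' y')) P) μ ν z := by
  unfold ExpKernelCalculus.hessKer
  rw [tadpole_conj_kernel hP hK (hW μ 0 ν z), bubble_conj_kernel hP hK (hV μ 0) (hV ν z)]

/-! ## §4 The packing column of a conjugated kernel (the (T-col) half, generic) -/

section Column

open OneStepResolventKernel (Fib)
open OneStepKernelFamily (colH)

variable {d : ℕ}

/-- [folklore] **THE `ℋ`-COLUMN OF A CONJUGATED KERNEL IS THE WINDOW APPLIED TO THE `ℋ`-COLUMN** ((T-col) of `J1-DEFECT-WORDS.md` §2, generic): for a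
window kernel `P` whose multiplier block is the identity and whose mixed blocks vanish (leaf-03's `psiKS_inl_inr ∕ psiKS_inr_inl ∕ psiKS_inr_inr`),
`colH (P∘K∘Pᵀ) N μ y κ′ u = Σ'_x Σ_α P u x (inl κ′) (inl α) · colH K N μ y α x` — the packing weight of the conjugated kernel is the field block of `P`
acting on the packing weight of `K` (no summability needed: the multiplier leg of `Pᵀ` is a Kronecker delta). -/
theorem colH_conj_kernel (P K : MKer (d + 1) (Fib d)) (N : ℕ)
    (hPfm : ∀ x y (α m : Fin (d + 1)), P x y (Sum.inl α) (Sum.inr m) = 0)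
    (hPmf : ∀ x y (m α : Fin (d + 1)), P x y (Sum.inr m) (Sum.inl α) = 0)
    (hPmm : ∀ x y (m m' : Fin (d + 1)), P x y (Sum.inr m) (Sum.inr m') = if x = y ∧ m = m' then 1 else 0)
    (μ : Fin (d + 1)) (y : Fin (d + 1) → ℤ) (κ' : Fin (d + 1)) (u : Fin (d + 1) → ℤ) :
    colH (comp (comp P K) (trK P)) N μ y κ' u = ∑' x, ∑ α : Fin (d + 1), P u x (Sum.inl κ') (Sum.inl α) * colH K N μ y α x := by
  -- the outer composition: only `w = N • y`, `b = inr μ` survives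
  have h1 : colH (comp (comp P K) (trK P)) N μ y κ' u = comp P K u ((N : ℤ) • y) (Sum.inl κ') (Sum.inr μ) := by
    show (∑' w, ∑ b, comp P K u w (Sum.inl κ') b * trK P w ((N : ℤ) • y) b (Sum.inr μ)) = _
    have hrow : ∀ w, (∑ b, comp P K u w (Sum.inl κ') b * trK P w ((N : ℤ) • y) b (Sum.inr μ))
        = if w = (N : ℤ) • y then comp P K u w (Sum.inl κ') (Sum.inr μ) else 0 := by
      intro w
      rw [Fintype.sum_sum_type]
      have hl : ∑ β : Fin (d + 1), comp P K u w (Sum.inl κ') (Sum.inl β) * trK P w ((N : ℤ) • y) (Sum.inl β) (Sum.inr μ) = 0 :=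
        Finset.sum_eq_zero fun β _ => by
          rw [show trK P w ((N : ℤ) • y) (Sum.inl β) (Sum.inr μ) = P ((N : ℤ) • y) w (Sum.inr μ) (Sum.inl β) from rfl, hPmf, mul_zero]
      rw [hl, zero_add]
      have hr : ∀ m : Fin (d + 1), trK P w ((N : ℤ) • y) (Sum.inr m) (Sum.inr μ) = if w = (N : ℤ) • y ∧ m = μ then 1 else 0 := by
        intro m
        rw [show trK P w ((N : ℤ) • y) (Sum.inr m) (Sum.inr μ) = P ((N : ℤ) • y) w (Sum.inr μ) (Sum.inr m) from rfl, hPmm]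
        by_cases h : w = (N : ℤ) • y ∧ m = μ
        · rw [if_pos h, if_pos ⟨h.1.symm, h.2.symm⟩]
        · rw [if_neg h, if_neg fun h' => h ⟨h'.1.symm, h'.2.symm⟩]
      simp_rw [hr]
      by_cases hw : w = (N : ℤ) • y
      · rw [if_pos hw]
        simp only [hw, true_and, mul_ite, mul_one, mul_zero, Finset.sum_ite_eq', Finset.mem_univ, if_true]
      · rw [if_neg hw]
        exact Finset.sum_eq_zero fun m _ => by rw [if_neg fun h => hw h.1, mul_zero]
    simp_rw [hrow]
    exact tsum_ite_eq _ _
  rw [h1]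
  show (∑' x, ∑ a, P u x (Sum.inl κ') a * K x ((N : ℤ) • y) a (Sum.inr μ)) = _
  refine tsum_congr fun x => ?_
  rw [Fintype.sum_sum_type]
  have hm : ∑ m : Fin (d + 1), P u x (Sum.inl κ') (Sum.inr m) * K x ((N : ℤ) • y) (Sum.inr m) (Sum.inr μ) = 0 :=
    Finset.sum_eq_zero fun m _ => by rw [hPfm, zero_mul]
  rw [hm, add_zero]
  rfl

end Column

/-! ## §5 The word list of a jet defect at a fixed kernel (words file §4) -/

section Words

/-- [folklore] **BOTH SLOTS PERTURBED**: `bubble A (V + Vᵈ) (Z + Zᵈ) = bubble A V Z + bubble A V Zᵈ + bubble A Vᵈ Z + bubble A Vᵈ Zᵈ`. -/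
theorem bubble_add_add {A V Vd Z Zd : MKer D F} (hA : Spr A) (hV : Loc V) (hVd : Loc Vd) (hZ : Loc Z) (hZd : Loc Zd) :
    bubble A (V + Vd) (Z + Zd) = bubble A V Z + bubble A V Zd + bubble A Vd Z + bubble A Vd Zd := by
  rw [bubble_add_left hA hV hVd (hZ.add hZd), bubble_add_right hA hV hZ hZd, bubble_add_right hA hVd hZ hZd]
  ring



variable {K : MKer D F} {V Vd : Fin D → (Fin D → ℤ) → MKer D F} {W Wd : Fin D → (Fin D → ℤ) → Fin D → (Fin D → ℤ) → MKer D F}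

/-- [folklore] **THE FUNCTIONAL AT PERTURBED JETS, EXPANDED**:
`hessKer K (V + Vᵈ) (W + Wᵈ) μ ν z = hessKer K V W μ ν z + ½·tadpole K (Wᵈ μ 0 ν z) − ½·(bubble K (V μ 0) (Vᵈ ν z) + bubble K (Vᵈ μ 0) (V ν z)) − ½·bubble K (Vᵈ μ 0) (Vᵈ ν z)`. -/
theorem hessKer_add_add (hK : Spr K) (hV : ∀ μ y, Loc (V μ y)) (hVd : ∀ μ y, Loc (Vd μ y)) (hW : ∀ μ y ν y', Loc (W μ y ν y'))
    (hWd : ∀ μ y ν y', Loc (Wd μ y ν y')) (μ ν : Fin D) (z : Fin D → ℤ) :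
    hessKer K (V + Vd) (W + Wd) μ ν z
      = hessKer K V W μ ν z + (1 / 2) * tadpole K (Wd μ 0 ν z)
          - (1 / 2) * (bubble K (V μ 0) (Vd ν z) + bubble K (Vd μ 0) (V ν z)) - (1 / 2) * bubble K (Vd μ 0) (Vd ν z) := by
  unfold ExpKernelCalculus.hessKer
  rw [show (W + Wd) μ 0 ν z = W μ 0 ν z + Wd μ 0 ν z from rfl, show (V + Vd) μ 0 = V μ 0 + Vd μ 0 from rfl,
    show (V + Vd) ν z = V ν z + Vd ν z from rfl, tadpole_add hK (hW μ 0 ν z) (hWd μ 0 ν z),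
    bubble_add_add hK (hV μ 0) (hVd μ 0) (hV ν z) (hVd ν z)]
  ring

/-- [folklore] **THE DEFECT's WORD LIST** (words file §4): `hessKer K (V + Vᵈ) (W + Wᵈ) − hessKer K V W = (D-T) + (D-X) + (D-C)`, i.e.
`= ½·tadpole K (Wᵈ μ 0 ν z) − ½·(bubble K (V μ 0) (Vᵈ ν z) + bubble K (Vᵈ μ 0) (V ν z)) − ½·bubble K (Vᵈ μ 0) (Vᵈ ν z)`. -/
theorem hessKer_add_add_sub (hK : Spr K) (hV : ∀ μ y, Loc (V μ y)) (hVd : ∀ μ y, Loc (Vd μ y)) (hW : ∀ μ y ν y', Loc (W μ y ν y'))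
    (hWd : ∀ μ y ν y', Loc (Wd μ y ν y')) (μ ν : Fin D) (z : Fin D → ℤ) :
    hessKer K (V + Vd) (W + Wd) μ ν z - hessKer K V W μ ν z
      = (1 / 2) * tadpole K (Wd μ 0 ν z)
          - (1 / 2) * (bubble K (V μ 0) (Vd ν z) + bubble K (Vd μ 0) (V ν z)) - (1 / 2) * bubble K (Vd μ 0) (Vd ν z) := by
  rw [hessKer_add_add hK hV hVd hW hWd μ ν z]
  ring

/-- [folklore] **FIRST-ORDER DEFECT ONLY** (`Wᵈ = 0`): `hessKer K (V + Vᵈ) W − hessKer K V W = −½·(cross bubbles) − ½·bubble K Vᵈ Vᵈ`. -/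
theorem hessKer_add_left_sub (hK : Spr K) (hV : ∀ μ y, Loc (V μ y)) (hVd : ∀ μ y, Loc (Vd μ y))
    (W : Fin D → (Fin D → ℤ) → Fin D → (Fin D → ℤ) → MKer D F) (μ ν : Fin D) (z : Fin D → ℤ) :
    hessKer K (V + Vd) W μ ν z - hessKer K V W μ ν z
      = -((1 / 2) * (bubble K (V μ 0) (Vd ν z) + bubble K (Vd μ 0) (V ν z))) - (1 / 2) * bubble K (Vd μ 0) (Vd ν z) := by
  unfold ExpKernelCalculus.hessKer
  rw [show (V + Vd) μ 0 = V μ 0 + Vd μ 0 from rfl, show (V + Vd) ν z = V ν z + Vd ν z from rfl,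
    bubble_add_add hK (hV μ 0) (hVd μ 0) (hV ν z) (hVd ν z)]
  ring

/-- [folklore] **SECOND-ORDER DEFECT ONLY** (`Vᵈ = 0`): `hessKer K V (W + Wᵈ) − hessKer K V W = ½·tadpole K (Wᵈ μ 0 ν z)` — the (D-T)∕(D-R) words. -/
theorem hessKer_add_right_sub (hK : Spr K) (hW : ∀ μ y ν y', Loc (W μ y ν y')) (hWd : ∀ μ y ν y', Loc (Wd μ y ν y'))
    (V : Fin D → (Fin D → ℤ) → MKer D F) (μ ν : Fin D) (z : Fin D → ℤ) :
    hessKer K V (W + Wd) μ ν z - hessKer K V W μ ν z = (1 / 2) * tadpole K (Wd μ 0 ν z) := by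
  unfold ExpKernelCalculus.hessKer
  rw [show (W + Wd) μ 0 ν z = W μ 0 ν z + Wd μ 0 ν z from rfl, tadpole_add hK (hW μ 0 ν z) (hWd μ 0 ν z)]
  ring

end Words

end Summit.QuantumFields.BalabanUV.Beta.D1BFx.HessKerConjugation

end
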